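import Summits.Parity.GeneralizedHardyLittlewood.Theorems.PairsToGHL.Negative.ShiftPairDictionary
import Literature.NumberTheory.Sieve.LinearEquationsInPrimesProofs
import Literature.NumberTheory.Sieve.LinearEquationsInPrimesSingularSeries
import Literature.NumberTheory.Sieve.SingularSeriesProofs
import Literature.NumberTheory.LFunctions.MertensFormula
import HarnessLib

/-!
# Crux `AbsoluteUpgrade` (stmt-Parity-14116): the residual's size `log log N` is ATTAINED at `t = 2`

Companion to `Theorems/LeeYangFibresAbsoluteUpgradeSingularProductLogLog.lean` (S1 of the line `Sketch`:
`∏_p β_p ≤ C(t,L) (log log N)^{t-1}` uniformly) and to `…HighMass.lean` (singular mass unbounded at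
`t = 2`): here the upper bound is shown to be SHARP at `t = 2`.  For the shift pair `(n, n + w#)` with the
primorial `w# ≤ 4^w ≤ N` (`w = ⌊log₄ N⌋`), the primes `p ≤ w` contribute `β_p = p/(p-1) ≥ e^{1/p}` each,
so `∏_p β_p ≥ ½ exp(∑_{p ≤ w} 1/p) ≥ ½ e^{B₁ - 8/log 2} log w` by Mertens' second theorem with rate
(`Literature.NumberTheory.LFunctions.Mertens.abs_primeRecipSum_sub_le`), and `log w ≥ ½ log log N`:

* `singularProduct_primorialPair_ge_exp` — `∏_p β_p(n, n + w#) ≥ ½ exp(∑_{p ≤ w} 1/p)`;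
* `exists_pair_singularProduct_ge_loglog` — for all large `N` an admissible pair (`‖Ψ‖_N ≤ 3`, `β_∞ = N` on
  `[-N, N]`) with `∏_p β_p ≥ c · log log N`, `c > 0` absolute.

So at `(t, L) = (2, 3)` the gap between `RelativeDimOne` (error `ε (β_∞∏β_p + N)`) and `DimOne` (error
`ε N`) is a factor of exact order `log log N`, no more and no less.
-/

noncomputable section

namespace Summit.Parity.GeneralizedHardyLittlewood.Theorems.AbsoluteUpgrade

open MeasureTheory Finset Filter Literature.NumberTheory.Sieve
open scoped Topology
open Literature.NumberTheory.LFunctions.Mertens (primeRecipSum meisselMertens abs_primeRecipSum_sub_le)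
open Summit.Parity.GeneralizedHardyLittlewood.Theorems.PairsToGHL.Negative
  (localFactor_shiftPairSystem_of_dvd localFactor_shiftPairSystem_of_not_dvd
    isNondegenerateSystem_shiftPairSystem_iff affLinSize_shiftPairSystem_le archFactor_shiftPairSystem)

/-- `e^{1/p} ≤ p/(p-1)` for `p ≥ 2` (from `1 - x ≤ e^{-x}`). [folklore] -/
theorem exp_inv_le_div_pred {p : ℕ} (hp : 2 ≤ p) :
    Real.exp ((p : ℝ)⁻¹) ≤ (p : ℝ) / ((p : ℝ) - 1) := by
  have hp2 : (2 : ℝ) ≤ p := by exact_mod_cast hp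
  have hp0 : (0 : ℝ) < p := by linarith
  have hinv : (p : ℝ)⁻¹ ≤ 1 / 2 := by
    rw [inv_eq_one_div]
    exact one_div_le_one_div_of_le (by norm_num) hp2
  have hpos : 0 < 1 - (p : ℝ)⁻¹ := by linarith
  have h1 : 1 - (p : ℝ)⁻¹ ≤ Real.exp (-(p : ℝ)⁻¹) := by
    have := Real.add_one_le_exp (-(p : ℝ)⁻¹)
    linarith
  have h2 : Real.exp ((p : ℝ)⁻¹) = (Real.exp (-(p : ℝ)⁻¹))⁻¹ := by
    rw [Real.exp_neg, inv_inv]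
  rw [h2]
  calc (Real.exp (-(p : ℝ)⁻¹))⁻¹ ≤ (1 - (p : ℝ)⁻¹)⁻¹ := inv_anti₀ hpos h1
    _ = (p : ℝ) / ((p : ℝ) - 1) := by
        field_simp

/-- Every local factor of a shift pair `(n, n + h)` satisfies `β_p ≥ 1 - 1/(p-1)²` (equality if `p ∤ h`,
`β_p = p/(p-1) ≥ 1` if `p ∣ h`). [cite: GreenTao2010, Example 1] -/
theorem localFactor_natShiftPair_ge {p : ℕ} (hp : p.Prime) (h : ℕ) :
    1 - 1 / ((p : ℝ) - 1) ^ 2 ≤ localFactor (shiftPairSystem (h : ℤ)) p := by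
  have hp2 : (2 : ℝ) ≤ p := by exact_mod_cast hp.two_le
  by_cases hdvd : p ∣ h
  · rw [localFactor_shiftPairSystem_of_dvd hp hdvd]
    have h1 : 1 - 1 / ((p : ℝ) - 1) ^ 2 ≤ 1 := by
      have : 0 ≤ 1 / ((p : ℝ) - 1) ^ 2 := by positivity
      linarith
    have h2 : (1 : ℝ) ≤ (p : ℝ) / ((p : ℝ) - 1) := by
      rw [le_div_iff₀ (by linarith)]
      linarith
    exact h1.trans h2
  · rw [localFactor_shiftPairSystem_of_not_dvd hp hdvd]

/-- For `x ≥ w ≥ 2`: `∏_{p ≤ x} β_p(n, n + w#) ≥ ½ exp(∑_{p ≤ w} 1/p)`.  The primes `p ≤ w` divide `w#`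
and give `β_p = p/(p-1) ≥ e^{1/p}`; the primes `w < p ≤ x` give at least
`∏_{2 < p ≤ x} (1 - 1/(p-1)²) ≥ ½`. [cite: GreenTao2010, Example 1] -/
theorem singularProductPartial_primorialPair_ge_exp {w x : ℕ} (hw : 2 ≤ w) (hwx : w ≤ x) :
    (1 / 2) * Real.exp (∑ p ∈ Nat.primesLE w, (p : ℝ)⁻¹) ≤
      singularProductPartial (shiftPairSystem (primorial w : ℤ)) x := by
  set Ψ := shiftPairSystem (primorial w : ℤ) with hΨ
  unfold singularProductPartial
  rw [← Finset.prod_filter_mul_prod_filter_not (Nat.primesLE x) (fun p => p ≤ w)]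
  -- the small primes
  have hA : (Nat.primesLE x).filter (fun p => p ≤ w) = Nat.primesLE w := by
    ext p
    simp only [Finset.mem_filter, Nat.mem_primesLE]
    constructor
    · rintro ⟨⟨-, hp⟩, hpw⟩
      exact ⟨hpw, hp⟩
    · rintro ⟨hpw, hp⟩
      exact ⟨⟨hpw.trans hwx, hp⟩, hpw⟩
  have hsmall : Real.exp (∑ p ∈ Nat.primesLE w, (p : ℝ)⁻¹) ≤
      ∏ p ∈ (Nat.primesLE x).filter (fun p => p ≤ w), localFactor Ψ p := by
    rw [hA, Real.exp_sum]
    refine Finset.prod_le_prod (fun p _ => (Real.exp_pos _).le) fun p hp => ?_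
    obtain ⟨hpw, hpp⟩ := Nat.mem_primesLE.mp hp
    rw [hΨ, localFactor_shiftPairSystem_of_dvd hpp ((Nat.Prime.dvd_primorial_iff hpp).mpr hpw)]
    exact exp_inv_le_div_pred hpp.two_le
  -- the large primes
  have hsub : (Nat.primesLE x).filter (fun p => ¬ p ≤ w) ⊆ (Nat.primesLE x).filter (2 < ·) := by
    intro p hp
    obtain ⟨hp1, hp2⟩ := Finset.mem_filter.mp hp
    exact Finset.mem_filter.mpr ⟨hp1, by omega⟩
  have hlarge : 1 / 2 ≤ ∏ p ∈ (Nat.primesLE x).filter (fun p => ¬ p ≤ w), localFactor Ψ p := by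
    calc (1 : ℝ) / 2 ≤ twinPrimeConstPartial x := half_le_twinPrimeConstPartial x
      _ ≤ ∏ p ∈ (Nat.primesLE x).filter (fun p => ¬ p ≤ w), (1 - 1 / ((p : ℝ) - 1) ^ 2) := by
          unfold twinPrimeConstPartial
          rw [← Finset.prod_sdiff hsub]
          refine mul_le_of_le_one_left ?_ ?_
          · refine Finset.prod_nonneg fun p hp => ?_
            obtain ⟨-, hp2⟩ := Finset.mem_filter.mp hp
            exact twinPrimeConstFactor_nonneg (by omega)
          · refine Finset.prod_le_one (fun p hp => ?_) (fun p _ => twinPrimeConstFactor_le_one p)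
            obtain ⟨hp1, -⟩ := Finset.mem_sdiff.mp hp
            obtain ⟨-, hp2⟩ := Finset.mem_filter.mp hp1
            exact twinPrimeConstFactor_nonneg (by omega)
      _ ≤ ∏ p ∈ (Nat.primesLE x).filter (fun p => ¬ p ≤ w), localFactor Ψ p := by
          refine Finset.prod_le_prod (fun p hp => ?_) fun p hp => ?_
          · obtain ⟨-, hp2⟩ := Finset.mem_filter.mp hp
            exact twinPrimeConstFactor_nonneg (by omega)
          · obtain ⟨hp1, -⟩ := Finset.mem_filter.mp hp
            exact localFactor_natShiftPair_ge (Nat.mem_primesLE.mp hp1).2 _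
  calc (1 / 2) * Real.exp (∑ p ∈ Nat.primesLE w, (p : ℝ)⁻¹)
      = Real.exp (∑ p ∈ Nat.primesLE w, (p : ℝ)⁻¹) * (1 / 2) := by ring
    _ ≤ (∏ p ∈ (Nat.primesLE x).filter (fun p => p ≤ w), localFactor Ψ p) *
          ∏ p ∈ (Nat.primesLE x).filter (fun p => ¬ p ≤ w), localFactor Ψ p :=
        mul_le_mul hsmall hlarge (by norm_num)
          (Finset.prod_nonneg fun p _ => localFactor_nonneg Ψ p)

/-- `∏_p β_p(n, n + w#) ≥ ½ exp(∑_{p ≤ w} 1/p)` (`w ≥ 2`), by the convergence of the ordered partial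
products (`tendsto_singularProductPartial_holds`). [cite: GreenTao2010, Lemma 1.3] -/
theorem singularProduct_primorialPair_ge_exp {w : ℕ} (hw : 2 ≤ w) :
    (1 / 2) * Real.exp (∑ p ∈ Nat.primesLE w, (p : ℝ)⁻¹) ≤
      singularProduct (shiftPairSystem (primorial w : ℤ)) := by
  have hh : (primorial w : ℤ) ≠ 0 := by exact_mod_cast primorial_ne_zero w
  have hT := tendsto_singularProductPartial_holds 1 2 _ (isNondegenerateSystem_shiftPairSystem_iff.mpr hh)
  exact ge_of_tendsto hT (eventually_atTop.2 ⟨w, fun x hx =>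
    singularProductPartial_primorialPair_ge_exp hw hx⟩)

/-- Mertens' second theorem (tree, with rate `8/log x`) as a LOWER bound at integers `w ≥ 2`:
`exp(∑_{p ≤ w} 1/p) ≥ e^{B₁ - 8/log 2} · log w`. [cite: HardyWright2008, Thm 427] -/
theorem exp_sum_primesLE_inv_ge {w : ℕ} (hw : 2 ≤ w) :
    Real.exp (meisselMertens - 8 / Real.log 2) * Real.log w ≤
      Real.exp (∑ p ∈ Nat.primesLE w, (p : ℝ)⁻¹) := by
  have hw2 : (2 : ℝ) ≤ w := by exact_mod_cast hw
  have hlog2 : 0 < Real.log 2 := Real.log_pos (by norm_num)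
  have hlogw : Real.log 2 ≤ Real.log w := Real.log_le_log (by norm_num) hw2
  have hlogw0 : 0 < Real.log w := lt_of_lt_of_le hlog2 hlogw
  have hM := abs_primeRecipSum_sub_le hw2
  rw [primeRecipSum, Nat.floor_natCast] at hM
  have hrate : 8 / Real.log w ≤ 8 / Real.log 2 := div_le_div_of_nonneg_left (by norm_num) hlog2 hlogw
  have hlow : Real.log (Real.log w) + (meisselMertens - 8 / Real.log 2) ≤
      ∑ p ∈ Nat.primesLE w, (p : ℝ)⁻¹ := by
    have := (abs_le.mp hM).1
    linarith
  calc Real.exp (meisselMertens - 8 / Real.log 2) * Real.log w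
      = Real.exp (Real.log (Real.log w) + (meisselMertens - 8 / Real.log 2)) := by
        rw [Real.exp_add, Real.exp_log hlogw0, mul_comm]
    _ ≤ Real.exp (∑ p ∈ Nat.primesLE w, (p : ℝ)⁻¹) := Real.exp_le_exp.mpr hlow

/-- `w = ⌊log₄ N⌋` satisfies `log w ≥ log log N - log(2 log 4)` for `N ≥ 16` (`4^{w+1} > N`, so
`w ≥ log N / log 4 - 1 ≥ log N / (2 log 4)`). [folklore] -/
theorem log_natLog_four_ge {N : ℕ} (hN : 16 ≤ N) :
    Real.log (Real.log N) - Real.log (2 * Real.log 4) ≤ Real.log (Nat.log 4 N : ℕ) := by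
  set w := Nat.log 4 N with hw
  have hN0 : N ≠ 0 := by omega
  have hNr : (16 : ℝ) ≤ N := by exact_mod_cast hN
  have hlog4 : 0 < Real.log 4 := Real.log_pos (by norm_num)
  have hlogN : Real.log 16 ≤ Real.log N := Real.log_le_log (by norm_num) hNr
  have h16 : Real.log 16 = 2 * Real.log 4 := by
    rw [show (16 : ℝ) = 4 ^ 2 by norm_num, Real.log_pow]; norm_num
  -- `N < 4^(w+1)` gives `log N < (w + 1) log 4`
  have hlt : N < 4 ^ (w + 1) := Nat.lt_pow_succ_log_self (by norm_num) N
  have hltr : Real.log N < ((w : ℝ) + 1) * Real.log 4 := by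
    have h' : (N : ℝ) < (4 : ℝ) ^ (w + 1) := by exact_mod_cast hlt
    have := Real.log_lt_log (by positivity) h'
    rwa [Real.log_pow, Nat.cast_add, Nat.cast_one] at this
  -- hence `w ≥ log N / (2 log 4)`
  have h2log4 : 0 < 2 * Real.log 4 := by positivity
  have hlogNpos : 0 < Real.log N := lt_of_lt_of_le (by rw [h16]; positivity) hlogN
  have hwge : Real.log N / (2 * Real.log 4) ≤ w := by
    rw [div_le_iff₀ h2log4]
    nlinarith
  have hquot : 0 < Real.log N / (2 * Real.log 4) := div_pos hlogNpos h2log4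
  calc Real.log (Real.log N) - Real.log (2 * Real.log 4)
      = Real.log (Real.log N / (2 * Real.log 4)) := by
        rw [Real.log_div hlogNpos.ne' h2log4.ne']
    _ ≤ Real.log w := Real.log_le_log hquot hwge

/-- **The `log log N` size is attained at `t = 2`.** There are an absolute `c > 0` and `N₀` such that for
every `N ≥ N₀` the shift pair `Ψ = (n, n + w#)`, `w = ⌊log₄ N⌋` (`w# ≤ 4^w ≤ N`, so `‖Ψ‖_N ≤ 3` and `Ψ` is
non-degenerate) has `∏_p β_p ≥ c · log log N`, with `β_∞ = N` on `K = [-N, N]`; together with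
`stub_singularProduct_le_loglog_pow` (`≤ C log log N` at `t = 2`) the gap between `RelativeDimOne` and
`DimOne` at `(t, L) = (2, 3)` is a factor of exact order `log log N`.
[cite: GreenTao2010, Example 1 and Lemma 1.3] [cite: HardyWright2008, Thm 427] -/
theorem exists_pair_singularProduct_ge_loglog :
    ∃ c : ℝ, 0 < c ∧ ∃ N₀ : ℕ, ∀ N : ℕ, N₀ ≤ N →
      ∃ Ψ : Fin 2 → AffLinForm 1, IsNondegenerateSystem Ψ ∧ affLinSize Ψ N ≤ 3 ∧
        archFactor Ψ (realBox 1 N) = N ∧ c * Real.log (Real.log N) ≤ singularProduct Ψ := by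
  set c₀ : ℝ := Real.exp (meisselMertens - 8 / Real.log 2) with hc₀
  have hc₀pos : 0 < c₀ := Real.exp_pos _
  -- eventually `log (2 log 4) ≤ ½ log log N`
  have hll : Tendsto (fun N : ℕ => Real.log (Real.log N)) atTop atTop :=
    (Real.tendsto_log_atTop.comp Real.tendsto_log_atTop).comp tendsto_natCast_atTop_atTop
  obtain ⟨N₁, hN₁⟩ := eventually_atTop.mp (hll.eventually_ge_atTop (2 * Real.log (2 * Real.log 4)))
  refine ⟨c₀ / 4, by positivity, max N₁ 16, fun N hN => ?_⟩
  have hN16 : 16 ≤ N := le_trans (le_max_right _ _) hN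
  have hN1 : N₁ ≤ N := le_trans (le_max_left _ _) hN
  have hN0 : N ≠ 0 := by omega
  set w := Nat.log 4 N with hw
  have hw2 : 2 ≤ w := by
    rw [hw, Nat.le_log_iff_pow_le (by norm_num) hN0]
    omega
  have hprim : primorial w ≤ N := (primorial_le_four_pow w).trans (Nat.pow_log_le_self 4 hN0)
  have hprim0 : primorial w ≠ 0 := primorial_ne_zero w
  refine ⟨shiftPairSystem (primorial w : ℤ),
    isNondegenerateSystem_shiftPairSystem_iff.mpr (by exact_mod_cast hprim0),
    affLinSize_shiftPairSystem_le (by omega) hprim, archFactor_shiftPairSystem _ _, ?_⟩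
  -- `c₀ log w ≤ exp(∑ 1/p) ≤ 2 ∏ β_p` and `log w ≥ ½ log log N`
  have hlogw : Real.log (Real.log N) / 2 ≤ Real.log w := by
    have h1 := log_natLog_four_ge hN16
    have h2 := hN₁ N hN1
    rw [← hw] at h1
    linarith
  have hS := singularProduct_primorialPair_ge_exp hw2
  have hE := exp_sum_primesLE_inv_ge hw2
  calc c₀ / 4 * Real.log (Real.log N) = (1 / 2) * (c₀ * (Real.log (Real.log N) / 2)) := by ring
    _ ≤ (1 / 2) * (c₀ * Real.log w) := by gcongr
    _ ≤ (1 / 2) * Real.exp (∑ p ∈ Nat.primesLE w, (p : ℝ)⁻¹) := by gcongr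
    _ ≤ singularProduct (shiftPairSystem (primorial w : ℤ)) := hS

end Summit.Parity.GeneralizedHardyLittlewood.Theorems.AbsoluteUpgrade

end
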